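import Summits.CriticalPhenomena.SAWScalingLimit.Theorems.SAWLoopFugacityFlowIsingBoundaryRatioRSWMeshDefs
import Literature.Probability.RandomPlanarGeometry.ChordalCapacityDivergence
import HarnessLib

/-!
# Anchor walk at the marked prime end (GEO-3)
(line `fk-anchor-transfer`, crux `SAWLoopFugacityFlow.IsingBoundaryRatio`, stmt-CriticalPhenomena-10650)

For the chordal chart `φ : ℍ → D` of a Dobrushin domain `(D; a, b)`, `a = D.pt 0`, and `ε, s > 0`
there is `r > 0` such that for all small meshes `δ` and every finite-volume graph `(G, Λ)` agreeing
locally with `Ω_δ` in `B(a, ε)` (`LocalAgreement`), any two anchors `x, x' ∈ Λ` that are vertices of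
`Ω_δ` with mesh point within `r` of `a` are joined, inside `H = G.comap val` on `↥Λ`, by a walk all of
whose vertices are vertices of `Ω_δ` with mesh point in `B(a, ε)` and chart radius `< s`.

Proof. By `φ⁻¹ → 0` at `a` (`MarkedDomain.IsChordalUniformizing.tendsto_symm_nhds_zero`) points of `D`
close to `a` have small chart radius. Shrink `ε` to `ε' ≤ ε` so that `D ∩ B(a, ε')` has chart radius
`< s`, take `R₀` from `ChartDiscOneComponent` at `ε'`, `R = R₀ / 2`, and `r` with
`D ∩ B(a, r) ⊆ {chart radius < R}`. Two anchors within `r` of `a` are then joined by a walk of `Ω_δ` with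
all mesh points in `B(a, ε')`; such a walk lifts edge by edge to `H` by `LocalAgreement` (every vertex
met lies in `Λ` and has the same neighbours in `G` as in `Ω_δ`). All statements here are folklore.
-/

noncomputable section

open scoped Classical Topology
open Filter Set Metric SimpleGraph
open Literature.Probability.LatticeModels Literature.Probability.RandomPlanarGeometry
open UpperHalfPlane (upperHalfPlaneSet)

namespace Summit.CriticalPhenomena.SAWScalingLimit.Theorems.IsingBoundaryRatio

/-! ### Walk bookkeeping -/

/-- **Vertices of a walk of `Ω_δ` are vertices of `Ω_δ`** (given that the start is: the nil walk has no
edge to read this off). [folklore] -/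
theorem forall_mem_support_mem_meshDomain {Ω : Set ℂ} {δ : ℝ} :
    ∀ {a b : Site 2} (w : (discreteDomainGraph Ω δ).Walk a b), a ∈ meshDomain Ω δ →
      ∀ z ∈ w.support, z ∈ meshDomain Ω δ
  | _, _, Walk.nil, ha, z, hz => by
    rw [Walk.support_nil, List.mem_singleton] at hz
    rw [hz]
    exact ha
  | _, _, Walk.cons h q, ha, z, hz => by
    rw [Walk.support_cons, List.mem_cons] at hz
    rcases hz with rfl | hz
    · exact ha
    · exact forall_mem_support_mem_meshDomain q (discreteDomainGraph_adj_iff.1 h).2.2 z hz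

/-- **Lifting a walk of `Ω_δ` to a locally agreeing finite volume**: if `(G, Λ)` agrees locally with
`Ω_δ` in `B(p, ε)`, a walk of `Ω_δ` starting in `Λ` all of whose vertices have mesh point in `B(p, ε)`
is a walk of `G.comap val` on `↥Λ` (every vertex met lies in `Λ`, every edge is an edge of `G`), with
the same vertices. [folklore] -/
theorem exists_walk_comap_of_localAgreement {Ω : Set ℂ} {p : ℂ} {ε δ : ℝ} {G : SimpleGraph (Site 2)}
    {Λ : Finset (Site 2)} (hLA : LocalAgreement Ω p ε δ G Λ) :
    ∀ {a b : Site 2} (w : (discreteDomainGraph Ω δ).Walk a b) (ha : a ∈ Λ) (hb : b ∈ Λ),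
      (∀ z ∈ w.support, meshPoint δ z ∈ Metric.ball p ε) →
      ∃ w' : (G.comap (Subtype.val : ↥Λ → Site 2)).Walk ⟨a, ha⟩ ⟨b, hb⟩,
        ∀ z ∈ w'.support, z.1 ∈ w.support
  | a, _, Walk.nil, ha, _, _ => ⟨Walk.nil, fun z hz => by
      rw [Walk.support_nil, List.mem_singleton] at hz
      rw [hz, Walk.support_nil, List.mem_singleton]⟩
  | a, b, Walk.cons (v := x) h q, ha, hb, hball => by
    have hpa : meshPoint δ a ∈ Metric.ball p ε := hball a (Walk.start_mem_support _)
    obtain ⟨hiff, himp⟩ := hLA a ha hpa x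
    have hx : x ∈ Λ := himp h
    have hG : G.Adj a x := hiff.2 h
    have hadj : (G.comap (Subtype.val : ↥Λ → Site 2)).Adj ⟨a, ha⟩ ⟨x, hx⟩ := hG
    obtain ⟨w', hw'⟩ := exists_walk_comap_of_localAgreement hLA q hx hb
      (fun z hz => hball z (by rw [Walk.support_cons]; exact List.mem_cons_of_mem _ hz))
    refine ⟨Walk.cons hadj w', fun z hz => ?_⟩
    rw [Walk.support_cons, List.mem_cons] at hz
    rw [Walk.support_cons, List.mem_cons]
    rcases hz with rfl | hz
    · exact Or.inl rfl
    · exact Or.inr (hw' z hz)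

/-! ### The theorem -/

/-- **Anchor walk at the marked prime end** (GEO-3). For the chordal chart `φ` of `(D; a, b)` and
`ε, s > 0` there is `r > 0` such that for all small `δ` and every finite volume `(G, Λ)` agreeing
locally with `Ω_δ` in `B(a, ε)`, any two anchors of `Λ` that are vertices of `Ω_δ` with mesh point
within `r` of `a` are joined in `G.comap val` by a walk all of whose vertices are vertices of `Ω_δ`
with mesh point in `B(a, ε)` and chart radius `< s`. [folklore] -/
theorem eventually_anchor_walk :
    ∀ (D : DobrushinDomain) (φ : ConformalEquiv upperHalfPlaneSet D.carrier), D.IsChordalUniformizing φ →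
      ChartDiscOneComponent →
    ∀ (ε s : ℝ), 0 < ε → 0 < s → ∃ r : ℝ, 0 < r ∧ ∀ᶠ δ in 𝓝[>] (0 : ℝ),
      ∀ (G : SimpleGraph (Site 2)) [G.LocallyFinite] (Λ : Finset (Site 2)),
        LocalAgreement D.carrier (D.pt 0) ε δ G Λ →
        ∀ (x x' : ↥Λ), x.1 ∈ meshDomain D.carrier δ → x'.1 ∈ meshDomain D.carrier δ →
          dist (meshPoint δ x.1) (D.pt 0) < r → dist (meshPoint δ x'.1) (D.pt 0) < r →
          ∃ w : (G.comap (Subtype.val : ↥Λ → Site 2)).Walk x x',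
            ∀ z ∈ w.support, z.1 ∈ meshDomain D.carrier δ ∧ meshPoint δ z.1 ∈ Metric.ball (D.pt 0) ε ∧
              ‖φ.symm (meshPoint δ z.1)‖ < s := by
  intro D φ hφ h1 ε s hε hs
  -- (a) points of `D` close to `a` have small chart radius
  have hsmall : ∀ t : ℝ, 0 < t → ∃ r : ℝ, 0 < r ∧ ∀ z ∈ D.carrier, dist z (D.pt 0) < r →
      ‖φ.symm z‖ < t := by
    intro t ht
    obtain ⟨r, hr, h⟩ := Metric.tendsto_nhdsWithin_nhds.1 hφ.tendsto_symm_nhds_zero t ht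
    exact ⟨r, hr, fun z hz hzr => by simpa [dist_zero_right] using h hz hzr⟩
  -- (b) the shrunken ball, the radius `R` of `ChartDiscOneComponent`, and `r`
  obtain ⟨rs, hrs, hrs'⟩ := hsmall s hs
  set ε' : ℝ := min ε rs with hε'def
  have hε' : 0 < ε' := lt_min hε hrs
  obtain ⟨R₀, hR₀, hR₀'⟩ := h1 D φ hφ ε' hε'
  have hE := hR₀' (R₀ / 2) (half_pos hR₀) (half_lt_self hR₀)
  obtain ⟨r, hr, hr'⟩ := hsmall (R₀ / 2) (half_pos hR₀)
  refine ⟨r, hr, ?_⟩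
  filter_upwards [hE] with δ hδ G _ Λ hLA x x' hx hx' hdx hdx'
  -- (d) the walk of `Ω_δ`
  have hxD : meshPoint δ x.1 ∈ D.carrier := meshDomain_subset_meshVertices _ _ hx
  have hx'D : meshPoint δ x'.1 ∈ D.carrier := meshDomain_subset_meshVertices _ _ hx'
  obtain ⟨w₀, hw₀⟩ := hδ x.1 hx x'.1 hx' (hr' _ hxD hdx) (hr' _ hx'D hdx')
  -- (e) its lift to `G.comap val`
  obtain ⟨w, hw⟩ := exists_walk_comap_of_localAgreement hLA w₀ x.2 x'.2
    (fun z hz => Metric.ball_subset_ball (min_le_left _ _) (hw₀ z hz))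
  refine ⟨w, fun z hz => ?_⟩
  have hz₀ : z.1 ∈ w₀.support := hw z hz
  have hzD : z.1 ∈ meshDomain D.carrier δ := forall_mem_support_mem_meshDomain w₀ hx z.1 hz₀
  have hzb : meshPoint δ z.1 ∈ Metric.ball (D.pt 0) ε' := hw₀ z.1 hz₀
  refine ⟨hzD, Metric.ball_subset_ball (min_le_left _ _) hzb, ?_⟩
  exact hrs' _ (meshDomain_subset_meshVertices _ _ hzD)
    (lt_of_lt_of_le (Metric.mem_ball.1 hzb) (min_le_right _ _))

end Summit.CriticalPhenomena.SAWScalingLimit.Theorems.IsingBoundaryRatio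

end
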